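import Summits.BirchSwinnertonDyer.BirchSwinnertonDyer.Theses.SignedLowerHalves
import Summits.BirchSwinnertonDyer.BirchSwinnertonDyer.Theorems.SignedLowerHalvesSprungLowerDivisibilityAtThreeKatoSporadicLedgerKato
import Summits.BirchSwinnertonDyer.BirchSwinnertonDyer.Theorems.SignedLowerHalvesSprungLowerDivisibilityAtThreeKatoSporadicLedgerX8
import Summits.BirchSwinnertonDyer.BirchSwinnertonDyer.Theorems.SignedLowerHalvesSprungLowerDivisibilityAtThreeBothColours
import Summits.BirchSwinnertonDyer.BirchSwinnertonDyer.Theorems.SignedLowerHalvesSprungLowerDivisibilityAtThreeIotaSharpRow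
import Summits.BirchSwinnertonDyer.BirchSwinnertonDyer.Theorems.SignedLowerHalvesSprungLowerDivisibilityAtThreeCyclotomicPosLevelLedgerOrbit
import Literature.NumberTheory.EllipticCurves.Sprung2012.SharpFlatSelmerDualInvolutionTwistProofs
import Literature.NumberTheory.EllipticCurves.CyclotomicIwasawaMainTheoremIrreducibleProofs
import HarnessLib

/-!
# Negative lemma for the crux `SprungLowerDivisibilityAtThree` (item stmt-BirchSwinnertonDyer-19875), sharpened: the TYPED
# crux contradicts Kato's divisibility IN PRINT KEYING on any X8 pair whose `L♯` has a private sporadic zero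

Cell `bsd-ssimc` (host), LEAD seat `cruxlead-stmt-BirchSwinnertonDyer-19875` (gen 5); `--negative-modulo
NaturalKatoSharpPrivateZero --supports stmt-BirchSwinnertonDyer-19875`. Sequel of
`…FalseOfKeyedSharpPrivateZero` (same seat): its hypothesis package had four conjuncts — (i) a tree-keyed dual f.g. torsion,
(ii) a naturally-keyed dual with Kato's divisibility, (iii) the keying dictionary, (iv) a private sporadic zero of `L♯`. The
width seat's `Sprung2012/SharpFlatSelmerDualInvolutionTwistProofs` (p660895; H1a of the crux dossier: uniqueness of
`X^•(E/K_∞)` at every key, the `γ ↦ γ⁻¹` re-keying is the `ι`-twist, `sharpFlatSelmerDualData_lengthAt_eq_inv`,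
`…_finite_inv_iff`, `…_isTorsion_inv_iff`) and the any-key existence `nonempty_sharpFlatSelmerDualData'` DISCHARGE (i) and
(iii). What is left is nature only:
  `NaturalKatoSharpPrivateZero` := ONE X8 pair (with the crux's own binders) carrying a CONTRAGREDIENTLY keyed dual
  `D′ : SharpFlatSelmerDualData W κ γ⁻¹ …♯`, finitely generated torsion with `pⁿ·L♯ ∈ char D′.X` — Sprung 2012 Thm. 7.14 +
  Thm. 7.16 (Kato) AS PRINTED (x8 R-228 / T67: print's (3) / 7.16 are `Λ`-linear for the contragredient action) — and ONE
  private sporadic zero of `L♯` (a height-one `𝔭₀ ∌ p, T, Φ₃(1+T)` with `L♯ ∈ 𝔭₀`, `L♭ ∉ 𝔭₀`).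
THEN the typed crux is false (`SprungLowerDivisibilityAtThree_false_of_NaturalKatoSharpPrivateZero`; the chain of p660336 re-run
with the dictionary supplied by `sharpFlatSelmerDualData_lengthAt_eq_inv`). Neither conjunct is a tree
object today (7.14/7.16 are named facts typed in the OTHER keying; the zero is a per-pair numerical certificate), so the item
stays open; what the lemma records is that the crux AS TYPED is the `ι`-crossed statement «`ι(L^•) ∣ char X^•_nat`», refuted by
print + census, while Sprung's Main Conjecture 7.21 is untouched. BSD / K1 / leaf X8 are neither proved nor refuted here.

References: [Sprung2012] Thm. 7.14, Thm. 7.16 (p. 1504), Main Conj. 7.21 (p. 1505); [Kato2004Asterisque] Thm. 12.5 (p. 221),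
§17.13; [GreenbergLNM1716] §1 p. 60; [Greenberg1989] §0; x8 HOME `ref/REF-G23-R228-KEYING.md`, `LIT-T67-…md`; tree:
`…FalseOfKeyedSharpPrivateZero` (p660336, the four-conjunct form), `Sprung2012/SharpFlatSelmerDualInvolutionTwistProofs` (the dictionary),
`Sprung2012/SharpFlatSelmerDualExistsProofs` (`nonempty_sharpFlatSelmerDualData'`).
-/

set_option autoImplicit false
-- the problem directory `BirchSwinnertonDyer/BirchSwinnertonDyer` forces the duplicated namespace segment
set_option linter.dupNamespace false

noncomputable section

open scoped Classical NumberField MatrixGroups ModularForm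

open NumberField IsDedekindDomain CongruenceSubgroup WeierstrassCurve Field
  Literature.NumberTheory.EllipticCurves Literature.NumberTheory.EllipticCurves.ModularForms
  Literature.NumberTheory.EllipticCurves.ZpExtension Literature.NumberTheory.EllipticCurves.Sprung2017
  Literature.NumberTheory.EllipticCurves.Sprung2012 Literature.NumberTheory.EllipticCurves.Rank1Residual
  Literature.NumberTheory.EllipticCurves.IwasawaAlgebra Literature.NumberTheory.EllipticCurves.Kato2004
  Literature.NumberTheory.EllipticCurves.Module Literature.Barriers.BirchSwinnertonDyer
  Summit.BirchSwinnertonDyer.BirchSwinnertonDyer.Theorems.SmallImageSignedMuDefect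
  Summit.BirchSwinnertonDyer.BirchSwinnertonDyer.Theorems.ChromaticCommonZeros

namespace Summit.BirchSwinnertonDyer.BirchSwinnertonDyer.Theorems

/-- **The hypothesis `H` of the sharpened negative lemma: ONE X8 pair with Kato's divisibility for `♯` in PRINT keying and a
private sporadic zero of `L♯`** (a pure `∃`-package; nothing asserted; not a tree object today). In the setting of the crux's
binders (X8 pair `(W, p)`, cyclotomic `(κ, γ)` with `IsCyclotomicVariable p γ`, place `v ∣ p`, local lift `g`, Honda system
`(cneg, c)`, newform `f`, period ratio `ϖ`, Sprung pair `(L♯, L♭)`): a contragrediently keyed dual datum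
`D′ : SharpFlatSelmerDualData W κ γ⁻¹ … ♯` that is finitely generated torsion (Sprung 2012 Thm. 7.14) with
`pⁿ·L♯ ∈ char D′.X` for some `n` (Sprung 2012 Thm. 7.16 = Kato's divisibility, as printed), and a height-one prime `𝔭₀`
with `p, T, (1+T)²+(1+T)+1 ∉ 𝔭₀`, `L♯ ∈ 𝔭₀`, `L♭ ∉ 𝔭₀`. (Sources, prose only — a hypothesis package, not a citable fact:
Sprung 2012 Thm. 7.14 / 7.16; Kato 2004 Thm. 12.5; x8 R-228 / T67 for the keying; the x8 census for the zero.) -/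
def NaturalKatoSharpPrivateZero : Prop :=
  ∃ (W : WeierstrassCurve ℚ) (_ : W.IsElliptic) (_ : W.IsGloballyMinimal) (p : ℕ) (_ : Fact p.Prime)
    (_ : ClassX8 W p) (κ : ZpExtension ℚ p) (γ : Field.absoluteGaloisGroup ℚ)
    (_ : κ.IsCyclotomic) (_ : κ.IsTopGenerator γ) (_ : IsCyclotomicVariable p γ)
    (v : HeightOneSpectrum (𝓞 ℚ)) (_ : (p : 𝓞 ℚ) ∈ v.asIdeal)
    (g : Field.absoluteGaloisGroup (v.adicCompletion ℚ))
    (_ : κ.IsTopGenerator (resGalOfEmb (closureEmb (K := ℚ) (v.adicCompletion ℚ)) g))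
    (cneg : localPoints W (v.adicCompletion ℚ)) (c : ℕ → localPoints W (v.adicCompletion ℚ))
    (_ : IsHondaSystem κ (closureEmb (K := ℚ) (v.adicCompletion ℚ)) W (W.frobeniusTrace p) g cneg c)
    (N : ℕ) (_ : NeZero N) (f : CuspForm (Gamma0 N) 2) (ϖ : ℚ) (Lsharp Lflat : IwasawaAlgebra p)
    (_ : IsNewformOf W f) (_ : (ϖ : ℝ) * W.realPeriodRat = plusPeriod f)
    (_ : IsSprungPair f p (W.frobeniusTrace p) Lsharp Lflat)
    -- Sprung Thm. 7.14 + 7.16 for `♯` in print (contragredient) keying, for one dual datum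
    (D' : SharpFlatSelmerDualData W κ γ⁻¹ (closureEmb (K := ℚ) (v.adicCompletion ℚ)) (W.frobeniusTrace p) g c
      Chroma.sharp)
    (_ : Module.Finite (IwasawaAlgebra p) D'.X) (_ : Module.IsTorsion (IwasawaAlgebra p) D'.X)
    (_ : ∃ n : ℕ, (p : IwasawaAlgebra p) ^ n * Lsharp ∈ D'.charIdeal)
    -- a private sporadic zero of `L♯`
    (𝔭₀ : PrimeSpectrum (IwasawaAlgebra p)),
    𝔭₀.asIdeal.height = 1 ∧ (p : IwasawaAlgebra p) ∉ 𝔭₀.asIdeal ∧ (PowerSeries.X : IwasawaAlgebra p) ∉ 𝔭₀.asIdeal ∧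
      ((1 + PowerSeries.X : IwasawaAlgebra p) ^ 2 + (1 + PowerSeries.X) + 1) ∉ 𝔭₀.asIdeal ∧
      Lsharp ∈ 𝔭₀.asIdeal ∧ Lflat ∉ 𝔭₀.asIdeal

/-- **NEGATIVE LEMMA (sharpened): Kato's divisibility as printed + one private sporadic zero of `L♯` on one X8 pair refute the
TYPED crux.** `NaturalKatoSharpPrivateZero → ¬ SprungLowerDivisibilityAtThree`. Chain at the witness pair, colour `♯`, private
sporadic zero `𝔭₀`, with `D` ANY tree-keyed datum (`nonempty_sharpFlatSelmerDualData'`; f.g. torsion by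
`sharpFlatSelmerDualData_finite_inv_iff` / `…_isTorsion_inv_iff` from `D′`): the typed leaf at `D` gives `char D.X = (gen)`,
`ι gen = C(ϖ)·ι(L♯·h)`, so `1 ≤ ℓ_{𝔭₀} Λ/(L♯) ≤ ℓ_{𝔭₀} D.X`; the dictionary `sharpFlatSelmerDualData_lengthAt_eq_inv` (p660895)
gives `1 ≤ ℓ_{ι𝔭₀} D′.X`; Kato's natural divisibility gives `ℓ_{ι𝔭₀} D′.X ≤ ℓ_{ι𝔭₀} Λ/(pⁿ·L♯) = ℓ_{ι𝔭₀} Λ/(L♯)`, hence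
`L♯ ∈ ι𝔭₀`, i.e. `ι(L♯) ∈ 𝔭₀`; the X8 pair functional equation `ChromaticIota.ClassX8.mem_and_mem_iff_sharp_iotaPair` (R-221) then
puts `L♭ ∈ 𝔭₀` — contradiction. Reading: the typed leaf (tree-keyed `D`, (M)-oriented `L^•`) says «`ι(L^•) ∣ char X^•_nat`»;
Kato (print) says «`char X^•_nat ∣ pⁿ L^•`»; together `L♯ ∣ pⁿ·ι(L♯)·unit`, impossible at a private sporadic zero. The repaired leaf
(contragredient `D`, or `invol p` on `L^•`; director ruling (266): C′ as new Literature decls, consumers re-bound) is not touched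
by this witness. [cite: Sprung2012, Thm. 7.16 (p. 1504), Main Conj. 7.21 (p. 1505)] [cite: Sprung2017, Thm. 4.13 and Cor. 4.14]
[cite: Kato2004Asterisque, Thm. 12.5 (p. 221)] [cite: Greenberg1989, §0] -/
theorem SprungLowerDivisibilityAtThree_false_of_NaturalKatoSharpPrivateZero :
    NaturalKatoSharpPrivateZero →
      ¬ Summit.BirchSwinnertonDyer.BirchSwinnertonDyer.Theses.SignedLowerHalves.SprungLowerDivisibilityAtThree := by
  rintro ⟨W, hE, hGM, p, hp, hX, κ, γ, hκ, hγ, hcv, v, hv, g, hg, cneg, c, hH, N, hN, f, ϖ, Lsharp, Lflat, hf, hϖ, hSP,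
    D', hD'fin, hD't, ⟨n, hKato⟩, 𝔭₀, h𝔭₀, hp𝔭₀, hT𝔭₀, hΦ𝔭₀, hs𝔭₀, hf𝔭₀⟩ hK1
  haveI : NeZero N := hN
  -- a tree-keyed datum `D` (exists at every key); finitely generated torsion transported from `D′`
  obtain ⟨D⟩ := nonempty_sharpFlatSelmerDualData' W κ (closureEmb (K := ℚ) (v.adicCompletion ℚ))
    (W.frobeniusTrace p) g c Chroma.sharp γ
  haveI : Module.Finite (IwasawaAlgebra p) D.X := (sharpFlatSelmerDualData_finite_inv_iff D D').2 hD'fin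
  have hDt : Module.IsTorsion (IwasawaAlgebra p) D.X := (sharpFlatSelmerDualData_isTorsion_inv_iff D D').2 hD't
  -- the typed leaf at the tree-keyed dual `D`
  have hs0 : chromaticL Chroma.sharp Lsharp Lflat ≠ 0 :=
    ChromaticBothColours.ClassX8.chromaticL_ne_zero W p hX f Lsharp Lflat hf hSP Chroma.sharp
  obtain ⟨gen, h, hchar, hgen⟩ :=
    hK1 W p hX Chroma.sharp κ γ hκ hγ hcv v hv g hg cneg c hH N hN f ϖ Lsharp Lflat hf hϖ hSP hs0 D
  rw [chromaticL_sharp] at hgen hs0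
  have hϖ0 : ϖ ≠ 0 := hf.periodRatio_ne_zero hϖ
  have hgen0 : gen ≠ 0 := by
    intro h0
    apply Module.charIdeal_ne_bot (IwasawaAlgebra p) D.X
    rw [← SharpFlatSelmerDualData.charIdeal, hchar, h0, Ideal.span_singleton_eq_bot]
  -- (1) `1 ≤ ℓ_{𝔭₀} Λ/(L♯) ≤ ℓ_{𝔭₀} Λ/(L♯·h) = ℓ_{𝔭₀} Λ/(gen) = ℓ_{𝔭₀} D.X`
  have hL1 : 1 ≤ Module.lengthAt (IwasawaAlgebra p) (IwasawaAlgebra p ⧸ Ideal.span {Lsharp}) 𝔭₀ := by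
    rw [Order.one_le_iff_ne_zero, Ne, lengthAt_quotient_span_eq_zero_iff_not_mem Lsharp 𝔭₀]
    exact fun hnot => hnot hs𝔭₀
  have hDgen : Module.lengthAt (IwasawaAlgebra p) D.X 𝔭₀ =
      Module.lengthAt (IwasawaAlgebra p) (IwasawaAlgebra p ⧸ Ideal.span {gen}) 𝔭₀ := by
    have hby := isTorsionBy_quotient_span_singleton (R := IwasawaAlgebra p) gen
    refine SkinnerUrban2014.lengthAt_eq_of_charIdeal_eq hDt
      (fun y ↦ ⟨⟨gen, mem_nonZeroDivisors_of_ne_zero hgen0⟩, @hby y⟩) ?_ 𝔭₀ h𝔭₀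
    rw [Module.charIdeal_eq_span_of_lengthAt_eq_quotient hgen0 fun _ _ ↦ rfl, ← SharpFlatSelmerDualData.charIdeal]
    exact hchar
  have hD1 : 1 ≤ Module.lengthAt (IwasawaAlgebra p) D.X 𝔭₀ := by
    rw [hDgen, lengthAt_quotient_span_normalised_eq_of_natCast_p_not_mem hϖ0 hgen 𝔭₀ hp𝔭₀,
      lengthAt_quotient_span_singleton_mul h hs0 𝔭₀]
    exact hL1.trans le_self_add
  -- (2) the dictionary `ℓ_{𝔭₀} D.X = ℓ_{ι𝔭₀} D′.X` (p660895): `1 ≤ ℓ_{ι𝔭₀} D′.X`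
  rw [sharpFlatSelmerDualData_lengthAt_eq_inv D D' 𝔭₀] at hD1
  -- (3) Kato's natural divisibility at `ι𝔭₀`: `ℓ_{ι𝔭₀} D′.X ≤ ℓ_{ι𝔭₀} Λ/(pⁿ L♯) = ℓ_{ι𝔭₀} Λ/(L♯)`, so `L♯ ∈ ι𝔭₀`
  obtain ⟨h𝔮, hp𝔮⟩ := comap_invol_heightOne_not_mem 𝔭₀ h𝔭₀ hp𝔭₀
  have hpΛ : (p : IwasawaAlgebra p) ≠ 0 := by
    rw [← map_natCast (PowerSeries.C (R := ℤ_[p])) p]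
    exact (IwasawaAlgebra.prime_C p).ne_zero
  have hx0 : (p : IwasawaAlgebra p) ^ n * Lsharp ≠ 0 := mul_ne_zero (pow_ne_zero n hpΛ) hs0
  have h3 : Module.lengthAt (IwasawaAlgebra p) D'.X (PrimeSpectrum.comap (invol p).toRingHom 𝔭₀) ≤
      Module.lengthAt (IwasawaAlgebra p)
        (IwasawaAlgebra p ⧸ Ideal.span {(p : IwasawaAlgebra p) ^ n * Lsharp})
        (PrimeSpectrum.comap (invol p).toRingHom 𝔭₀) := by
    have hby := isTorsionBy_quotient_span_singleton (R := IwasawaAlgebra p) ((p : IwasawaAlgebra p) ^ n * Lsharp)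
    refine SkinnerUrban2014.lengthAt_le_of_charIdeal_le
      (M := IwasawaAlgebra p ⧸ Ideal.span {(p : IwasawaAlgebra p) ^ n * Lsharp}) (N := D'.X)
      (fun y ↦ ⟨⟨_, mem_nonZeroDivisors_of_ne_zero hx0⟩, @hby y⟩) hD't ?_ _ h𝔮
    rw [Module.charIdeal_eq_span_of_lengthAt_eq_quotient hx0 fun _ _ ↦ rfl, Ideal.span_singleton_le_iff_mem]
    exact hKato
  rw [lengthAt_quotient_span_natCast_pow_mul_eq_of_not_mem n Lsharp _ hp𝔮] at h3
  have hLι : Lsharp ∈ (PrimeSpectrum.comap (invol p).toRingHom 𝔭₀).asIdeal := by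
    by_contra hnot
    have h0 := (lengthAt_quotient_span_eq_zero_iff_not_mem Lsharp
      (PrimeSpectrum.comap (invol p).toRingHom 𝔭₀)).mpr hnot
    rw [h0] at h3
    exact one_ne_zero (le_antisymm (hD1.trans h3) bot_le)
  rw [PrimeSpectrum.comap_asIdeal, Ideal.mem_comap] at hLι
  change invol p Lsharp ∈ 𝔭₀.asIdeal at hLι
  rw [SignedKatoOffTwo.Invol.invol_eq_subst_invOnePlusSubOne] at hLι
  -- (4) the X8 pair functional equation: `L♯ ∈ 𝔭₀ ∧ ι(L♯) ∈ 𝔭₀ ⟹ L♭ ∈ 𝔭₀`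
  exact hf𝔭₀ ((ChromaticIota.ClassX8.mem_and_mem_iff_sharp_iotaPair W p hX f hf Lsharp Lflat hSP 𝔭₀.asIdeal
    𝔭₀.isPrime hp𝔭₀ hT𝔭₀ hΦ𝔭₀).mpr ⟨hs𝔭₀, hLι⟩).2

end Summit.BirchSwinnertonDyer.BirchSwinnertonDyer.Theorems

end
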